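/-
Copyright (c) 2026. All rights reserved.
Released under Apache 2.0 license as described in the file LICENSE.
-/
import Literature.Geometry.Kaehler.ComplexTorusQuaternionMaximalOrderEuclidean
import HarnessLib

/-!
# The Euclidean minimum of the maximal order `O₆` of `(−1,3)_ℚ` is EXACTLY `½` (attained), and that of Lang's
# order `𝔬` is EXACTLY `1` (attained) — Cerri–Chaubert–Lezowski 2014 Thm 3.4 (iii) and Lemma 3.7 for `D = 6`

[tag: complex_torus] [tag: abelian_surface] [tag: quaternion_multiplication] [tag: shimura_curve]
[tag: quaternion_order] [tag: maximal_order] [tag: euclidean_ring] [tag: euclidean_minimum]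

Lane `lit-hodgefound`, seat p12, row g34-#1 — THEOREMS ONLY (no definition, no named fact, no instance); the sequel of
g33-#2 `…MaximalOrderEuclidean`, whose honest scope left «the Euclidean minimum `M(O₆)` (Thm 3.4 (iii): `≤ M(ℚ) = ½`)
is not computed — only `m_{O₆}(ξ) < 1`». Setting as there: `B = (−1,3)_ℚ` (`D(B) = 6`), Lang's order
`𝔬 = ℤ⟨1, i, j, ij⟩ = order (-1) 3`, `e = (1 + i + j − ij)/2 = ⟨1/2, 1/2, 1/2, −1/2⟩`, the maximal order
`O₆ = 𝔬 ∪ (e + 𝔬)` as the predicate `x ∈ 𝔬 ∨ x − e ∈ 𝔬`, `nr x = re(x x̄) = x₀² + x₁² − 3x₂² − 3x₃²`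
(`re_mul_star_eq_coords`), `P₂ = (1 + i)O₆ = O₆(1 + i)` the two-sided prime above the ramified prime `2`
(g31-#3 `…LangOrderLevelTwo`), `1 + i = ⟨1, 1, 0, 0⟩` Bayer–Travesa's `w₂` of norm `2`.

## The print, VERBATIM (J.-P. Cerri, J. Chaubert, P. Lezowski, Acta Arith. 165 (2014) [CerriChaubertLezowski2014])

* §1 p. 181–182: «Let us denote by `N : F → ℚ_{≥0}` the absolute value of the reduced norm map `nrd_{F/ℚ} : F → ℚ`
  defined by `nrd_{F/ℚ} = N_{K/ℚ} ∘ nrd_{F/K}`. The map `N` is multiplicative»; Def. 1.2 p. 182: «An order `Λ` of `F` is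
  right-norm-Euclidean if for any `(a, b) ∈ Λ × Λ∖{0}`, there exists some `q ∈ Λ` such that (2) `N(a − bq) < N(b)`.»
* §2.3 p. 188: «Let us denote by `m_K` the local Euclidean minimum map of `K` (for the norm form) defined by
  `m_K(x) = inf_{X ∈ ℤ_K} |N_{K/ℚ}(x − X)|` for `x ∈ K`. Let `M(K) = sup_{x ∈ K} m_K(x)` be the Euclidean minimum of `K`.»
  **Definition 2.6.** «For any `ξ ∈ F`, we set `m_Λ(ξ) = inf_{λ ∈ Λ} N(ξ − λ)`, and we call it the local Euclidean
  minimum of `Λ` at `ξ`. We define the Euclidean minimum of `Λ` by `M(Λ) = sup_{ξ ∈ F} m_Λ(ξ)`. Let us notice that this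
  supremum is a well-defined positive real number and that for every `ξ ∈ F` there exists a `λ ∈ Λ` such that
  `m_Λ(ξ) = N(ξ − λ)`.» Prop. 2.7: «The following three statements are equivalent: (i) `Λ` is left-norm-Euclidean.
  (ii) `Λ` is right-norm-Euclidean. (iii) For all `ξ ∈ F`, `m_Λ(ξ) < 1`.» Prop. 2.8: «If `F` admits a norm-Euclidean
  (necessarily maximal) order `Λ`, then every maximal order `Λ′` of `F` is norm-Euclidean. Moreover, `M(Λ′) = M(Λ)`.»
  Remark 2.9: «Note that the latter equality is true as soon as `t_F = 1`»; p. 189: «if `t_F = 1`, in particular if `F`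
  is norm-Euclidean, we can speak without any ambiguity of its Euclidean minimum: `M(F) = M(Λ)` for any maximal order
  `Λ` of `F`.»
* **Lemma 3.1** p. 189: «let `Λ` be a maximal order of `F`. Then: (i) `nrd_{F/K}(F) = K`. (ii) `nrd_{F/K}(Λ) = ℤ_K`.
  (iii) For any `x ∈ Λ` and any integral two-sided ideal `I` of `Λ` such that `nrd_{F/K}(x)ℤ_K` and `nrd_{F/K}(I)` are
  coprime, we have `nrd_{F/K}(x + I) = nrd_{F/K}(x) + I ∩ ℤ_K`. … Statement (iii) is Eichler's Norm Theorem for the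
  arithmetic progression [6, Satz 5]».
* **Theorem 3.4** p. 182 / p. 190: «Let `F` be a totally indefinite quaternion field over a number field `K`. Then:
  (i) If `K` is Euclidean, then `F` is Euclidean. (ii) If `K` is norm-Euclidean, then `F` is norm-Euclidean. (iii) If
  the class number of `K` is equal to `1`, then for any maximal order `Λ` of `F`, we have `M(Λ) ≤ M(K)`.» Proof of
  (iii), p. 190–191: «Take `ξ ∈ F`. … `ξ = β⁻¹α + τ` for some `α, β, τ ∈ Λ` such that `nrd_{F/K}(α)` and `nrd_{F/K}(β)`
  are coprime. … Lemma 3.1 (iii) proves that `nrd(α) + nrd(β)ℤ_K = nrd(α + nrd(β)Λ) ⊆ nrd(α + βτ + βΛ)`. …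
  Therefore, `m_Λ(ξ) ≤ m_K(nrd_{F/K}(β⁻¹α)) ≤ M(K)`».
* **Lemma 3.7** p. 191: «Let `F` be a totally indefinite quaternion field over a number field `K` with `h_K = 1`. Let
  `p_i, 1 ≤ i ≤ s`, be some distinct finite places of `K` ramified in `F`, and `t ∈ ℤ_K` such that `tℤ_K = p₁⋯p_s` (we
  have `h_K = 1`). Then for any `v ∈ ℤ_K` coprime to `t`, there exists `ξ ∈ F` such that `m_Λ(ξ) ≥ m_K(v/t)`.» Proof,
  p. 191–192: «there exists an `a ∈ Λ` such that `nrd_{F/K}(a) = v`. … `P₁⋯P_s = bΛ`. Let us put `ξ = b⁻¹a ∈ F`. … As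
  `bλ ∈ P₁⋯P_s`, (6) shows that there exists a `y ∈ p₁⋯p_s = tℤ_K` with `nrd_{F/K}(a − bλ) = nrd_{F/K}(a) + y`. …
  `m_Λ(ξ) = |N_{K/ℚ}(v + tz)|/|N_{K/ℚ}(t)| = |N_{K/ℚ}(v/t + z)| ≥ m_K(v/t)`.»
* Corollary 3.5 p. 191: «Let `F` be a quaternion field over `ℚ`. Then `F` is Euclidean if and only if `F` is
  norm-Euclidean, which happens exactly when `F` is indefinite or `F ∈ {(−1,−1)_ℚ, (−1,−3)_ℚ, (−2,−5)_ℚ}`.»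

For `K = ℚ` (`h_ℚ = 1`, `M(ℚ) = m_ℚ(½) = ½`) and `F = B = (−1,3)_ℚ` (indefinite, `2 ∣ D(B) = 6` ramified, `t = 2`,
`P₂ = (1 + i)O₆`, `v = 1`, `a = 1`, `b = 1 + i`, `ξ = b⁻¹a = (1 + i)⁻¹ = (1 − i)/2 = ⟨½, −½, 0, 0⟩`), Thm 3.4 (iii)
and Lemma 3.7 say `M(O₆) ≤ ½` and `m_{O₆}((1 + i)⁻¹) ≥ ½`; together **`M(O₆) = M(ℚ) = ½`**, and by Prop. 2.8 /
Remark 2.9 (`t_B = 1`: g33-#2 `exists_unit_mem_iff_conj_maxOrder`) this is `M(B)`, the same for every maximal order.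

## What is proved (all statements in the `∀ ξ ∃ λ` / `∀ λ` form of Def. 2.6 — no `inf`/`sup` object is introduced)

* §1 `window_abs_le_half` (and the private `window_abs_le_one`): the covering lemmas on reduced coordinates `t ∈ [0, ½]⁴`.
* §2 **`M(O₆) ≤ ½` (Thm 3.4 (iii) for `D = 6`)** — `exists_maxOrder_abs_norm_sub_le_half`: for every `ξ ∈ B` there is
  `λ ∈ O₆` with `|nr(ξ − λ)| ≤ ½`. DEVIATION FROM THE PRINTED PROOF (stated, not hidden): the print derives (iii) from
  Eichler's Norm Theorem in arithmetic progressions (Lemma 3.1 (iii)), which the tree does not have; here the bound is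
  obtained by an explicit FIVE-CANDIDATE COVERING. Round each coordinate, `ξₖ = rₖ + σₖtₖ` with `rₖ ∈ ℤ`, `σₖ = ±1`,
  `tₖ ∈ [0, ½]`; put `A = t₀² + t₁² ≤ ½`, `b = 3(t₂² + t₃²) ≤ 3/2`. The four `𝔬`-translates `λ ∈ {r, r + σ₀e₀,
  r + σ₁e₁, r + σ₀e₀ + σ₁e₁}` give the norms `A − b`, `A + 1 − 2t₀ − b`, `A + 1 − 2t₁ − b`, `A + 2 − 2t₀ − 2t₁ − b`,
  four numbers with consecutive gaps `≤ 1`, so one of them lies in `[−½, ½]` as long as `b ≤ (1 − t₀)² + (1 − t₁)² +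
  ½`; beyond that threshold (`≥ 1`) one has `t₂² + t₃² ≥ ⅓`, whence (`tₖ ≥ 2tₖ²` on `[0, ½]`) `(½ − t₂)² + (½ − t₃)² ≤
  ½ − (t₂² + t₃²) ≤ ⅙`, and the `(e + 𝔬)`-translate `λ = r + Σ σₖeₖ/2` has norm `(½ − t₀)² + (½ − t₁)² − 3((½ − t₂)² +
  (½ − t₃)²) ∈ [−½, ½]`. The division form of Def. 1.2 with remainder AT MOST HALF the divisor:
  `exists_maxOrder_abs_norm_sub_mul_le_half` (`∀ a, ∀ b ≠ 0, ∃ q ∈ O₆, |nr(a − bq)| ≤ ½|nr b|`).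
* §3 **`m_{O₆}((1 + i)⁻¹) = ½`, ATTAINED (Lemma 3.7 for `t = 2`, `v = 1`, followed as printed)** — `one_add_i_mul_xi0`
  (`(1 + i)·ξ₀ = ξ₀·(1 + i) = 1`), `norm_xi0` (`nr ξ₀ = ½`), `exists_norm_xi0_sub_eq_add_half` (**`nr(ξ₀ − λ) ∈ ½ + ℤ`
  for every `λ ∈ O₆`**), `half_le_abs_norm_xi0_sub` (`½ ≤ |nr(ξ₀ − λ)|`); the print's mechanism (6) on `P₂`:
  `exists_norm_one_sub_eq_odd_of_primeTwo` (**`nr(1 − y)` is ODD for every `y ∈ P₂`**, i.e. `nrd(1 + P₂) ⊆ 1 + 2ℤ =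
  nrd(1) + P₂ ∩ ℤ`, the inclusion of Lemma 3.1 (iii) that Lemma 3.7 uses) and `one_le_abs_norm_one_sub_one_add_i_mul`
  (`1 = ½N(b) ≤ N(a − bq)` for `(a, b) = (1, 1 + i)` and every `q ∈ O₆`: the division bound of §2 is SHARP).
* §4 **`M(O₆) = ½`** packaged (`euclideanMinimum_maxOrder`: the `≤ ½` bound for all `ξ`, the `≥ ½` bound at `ξ₀` for
  all `λ`, and attainment `|nr(ξ₀ − 0)| = ½`), and **the same for every conjugate maximal order `uO₆u⁻¹`**
  (`exists_conj_maxOrder_abs_norm_sub_le_half`, `half_le_abs_norm_conj_xi0_sub`: Prop. 2.8 «`M(Λ′) = M(Λ)`», so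
  `M(B) = ½` in the sense of p. 189, all maximal orders being `uO₆u⁻¹` by g33-#2).
* §5 **LANG'S ORDER: `M(𝔬) = 1`, ATTAINED** — `exists_order_abs_norm_sub_le_one` (for every `ξ` some `γ ∈ 𝔬` has
  `|nr(ξ − γ)| ≤ 1`: the two candidates `r`, `r + σ₀e₀ + σ₁e₁` suffice) with g33-#2 `one_le_abs_norm_e_sub_order`
  (`|nr(e − γ)| ≥ 1` on `𝔬`) and `|nr e| = 1`: `euclideanMinimum_order`. This is exactly the boundary case excluded by
  Prop. 2.7 (iii) «`m_Λ(ξ) < 1`»: `𝔬` misses norm-Euclideanity by attaining `1` (g33-#2 `order_not_normEuclidean`).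

## Honest scope

No `inf`/`sup`-valued definition of `m_Λ`, `M(Λ)` is introduced (theorems only; `ℚ` is not conditionally complete and
the lane files no definitions from this seat): «`M(O₆) = ½`» is the conjunction (every `ξ` is served within `½`) ∧
(some `ξ` is never served below `½`) ∧ (that `ξ` is served at exactly `½`), likewise «`M(𝔬) = 1`». Only the
inclusion `nrd(1 + P₂) ⊆ 1 + 2ℤ` of Eichler's Lemma 3.1 (iii) is proved (the one Lemma 3.7 uses), not the equality;
Thm 3.4 (iii) is proved for THIS `F` by covering, not via Eichler. Nothing is said about other quaternion fields, about
`M(Λ)` for non-maximal orders other than `𝔬`, or about the set of `ξ` with `m_{O₆}(ξ) = ½` beyond `ξ₀` and its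
conjugates. 0 definitions, 0 named facts, 0 instances — net debt `0`.

## References
* [CerriChaubertLezowski2014] J.-P. Cerri, J. Chaubert, P. Lezowski, *Totally indefinite Euclidean quaternion fields*,
  Acta Arith. 165 (2014) 181–200: §1 Def. 1.2 (p. 182), §2.3 Def. 2.6, Prop. 2.7, Prop. 2.8, Remark 2.9 (p. 188–189),
  Lemma 3.1 (p. 189), Thm 3.4 with proof (p. 190–191), Cor. 3.5, Lemma 3.7 with proof (p. 191–192). doi:10.4064/aa165-2-4.
* [BayerTravesa2007] P. Bayer, A. Travesa, *Uniformizing functions for certain Shimura curves, in the case D = 6*, Acta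
  Arith. 126 (2007), §1 p. 316 (`O₆`), §2 p. 318 (`w₂ = 1 + i` of norm `2`).
* [VignerasLNM800] M.-F. Vignéras, *Arithmétique des algèbres de quaternions*, LNM 800 (1980), Ch. II §1 Lemme 1.5
  (the prime `P = Ou` above a ramified prime).
* [Lang1982AbelianFunctions] S. Lang, *Introduction to Algebraic and Abelian Functions*, 2nd ed. (1982), Ch. IX §4–§5
  (`(−1,3)_ℚ`, `𝔬`, `nr`).
-/

noncomputable section

set_option maxSynthPendingDepth 3

open Quaternion Function

namespace Literature.Geometry.Kaehler.ComplexTorus.QuaternionType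

/-! ## §1 The covering lemmas on reduced coordinates -/

section Window

/-- **The five-candidate window.** For reduced coordinates `t ∈ [0, ½]⁴` one of the five numbers
`t₀² + t₁² − b`, `(1 − t₀)² + t₁² − b`, `t₀² + (1 − t₁)² − b`, `(1 − t₀)² + (1 − t₁)² − b` (`b = 3t₂² + 3t₃²`),
`(½ − t₀)² + (½ − t₁)² − 3(½ − t₂)² − 3(½ − t₃)²` lies in `[−½, ½]`: the first four have consecutive gaps `≤ 1`
starting below `½`, and past the last of them `t₂² + t₃² ≥ ⅓` forces `(½ − t₂)² + (½ − t₃)² ≤ ⅙`. (The explicit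
substitute, for `F = (−1,3)_ℚ`, of the reduction to `M(ℚ) = ½` in the printed proof of Thm 3.4 (iii).)
[cite: CerriChaubertLezowski2014, Thm 3.4 (iii) (statement); proof replaced, see the module docstring] -/
theorem window_abs_le_half (t0 t1 t2 t3 : ℚ) (h0 : 0 ≤ t0) (h0' : t0 ≤ 1 / 2) (h1 : 0 ≤ t1)
    (h1' : t1 ≤ 1 / 2) (h2 : 0 ≤ t2) (h2' : t2 ≤ 1 / 2) (h3 : 0 ≤ t3) (h3' : t3 ≤ 1 / 2) :
    |t0 ^ 2 + t1 ^ 2 - 3 * t2 ^ 2 - 3 * t3 ^ 2| ≤ 1 / 2 ∨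
    |(1 - t0) ^ 2 + t1 ^ 2 - 3 * t2 ^ 2 - 3 * t3 ^ 2| ≤ 1 / 2 ∨
    |t0 ^ 2 + (1 - t1) ^ 2 - 3 * t2 ^ 2 - 3 * t3 ^ 2| ≤ 1 / 2 ∨
    |(1 - t0) ^ 2 + (1 - t1) ^ 2 - 3 * t2 ^ 2 - 3 * t3 ^ 2| ≤ 1 / 2 ∨
    |(1 / 2 - t0) ^ 2 + (1 / 2 - t1) ^ 2 - 3 * (1 / 2 - t2) ^ 2 - 3 * (1 / 2 - t3) ^ 2| ≤ 1 / 2 := by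
  -- quadratic facts, used linearly below
  have k0 : 2 * t0 ^ 2 ≤ t0 := by nlinarith [mul_nonneg h0 (sub_nonneg.mpr h0')]
  have k1 : 2 * t1 ^ 2 ≤ t1 := by nlinarith [mul_nonneg h1 (sub_nonneg.mpr h1')]
  have k2 : 2 * t2 ^ 2 ≤ t2 := by nlinarith [mul_nonneg h2 (sub_nonneg.mpr h2')]
  have k3 : 2 * t3 ^ 2 ≤ t3 := by nlinarith [mul_nonneg h3 (sub_nonneg.mpr h3')]
  have q2 : 0 ≤ t2 ^ 2 := sq_nonneg _
  have q3 : 0 ≤ t3 ^ 2 := sq_nonneg _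
  have p0 : 0 ≤ 1 - 3 * t0 + 2 * t0 ^ 2 := by
    nlinarith [mul_nonneg (sub_nonneg.mpr h0') (by linarith : (0 : ℚ) ≤ 1 - t0)]
  have p1 : 0 ≤ 1 - 3 * t1 + 2 * t1 ^ 2 := by
    nlinarith [mul_nonneg (sub_nonneg.mpr h1') (by linarith : (0 : ℚ) ≤ 1 - t1)]
  have g2 : t2 - t2 ^ 2 ≤ 1 / 4 := by nlinarith [sq_nonneg (1 / 2 - t2)]
  have g3 : t3 - t3 ^ 2 ≤ 1 / 4 := by nlinarith [sq_nonneg (1 / 2 - t3)]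
  have e0 : (1 - t0) ^ 2 = 1 - 2 * t0 + t0 ^ 2 := by ring
  have e1 : (1 - t1) ^ 2 = 1 - 2 * t1 + t1 ^ 2 := by ring
  have f0 : (1 / 2 - t0) ^ 2 = 1 / 4 - t0 + t0 ^ 2 := by ring
  have f1 : (1 / 2 - t1) ^ 2 = 1 / 4 - t1 + t1 ^ 2 := by ring
  have f2 : (1 / 2 - t2) ^ 2 = 1 / 4 - t2 + t2 ^ 2 := by ring
  have f3 : (1 / 2 - t3) ^ 2 = 1 / 4 - t3 + t3 ^ 2 := by ring
  rw [e0, e1, f0, f1, f2, f3]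
  by_cases c1 : 3 * t2 ^ 2 + 3 * t3 ^ 2 ≤ t0 ^ 2 + t1 ^ 2 + 1 / 2
  · exact Or.inl (abs_le.mpr ⟨by linarith, by linarith⟩)
  rcases le_total t0 t1 with h01 | h10
  · -- `t1` is the larger fractional part: shifting it adds the smaller increment `1 − 2t₁`
    by_cases c2 : 3 * t2 ^ 2 + 3 * t3 ^ 2 ≤ t0 ^ 2 + t1 ^ 2 + 3 / 2 - 2 * t1
    · exact Or.inr (Or.inr (Or.inl (abs_le.mpr ⟨by linarith, by linarith⟩)))
    by_cases c3 : 3 * t2 ^ 2 + 3 * t3 ^ 2 ≤ t0 ^ 2 + t1 ^ 2 + 3 / 2 - 2 * t0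
    · exact Or.inr (Or.inl (abs_le.mpr ⟨by linarith, by linarith⟩))
    by_cases c4 : 3 * t2 ^ 2 + 3 * t3 ^ 2 ≤ t0 ^ 2 + t1 ^ 2 + 5 / 2 - 2 * t0 - 2 * t1
    · exact Or.inr (Or.inr (Or.inr (Or.inl (abs_le.mpr ⟨by linarith, by linarith⟩))))
    -- the half-integral coset: `t₂² + t₃² ≥ ⅓` forces `(½ − t₂)² + (½ − t₃)² ≤ ⅙`
    exact Or.inr (Or.inr (Or.inr (Or.inr (abs_le.mpr ⟨by linarith, by linarith⟩))))
  · by_cases c2 : 3 * t2 ^ 2 + 3 * t3 ^ 2 ≤ t0 ^ 2 + t1 ^ 2 + 3 / 2 - 2 * t0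
    · exact Or.inr (Or.inl (abs_le.mpr ⟨by linarith, by linarith⟩))
    by_cases c3 : 3 * t2 ^ 2 + 3 * t3 ^ 2 ≤ t0 ^ 2 + t1 ^ 2 + 3 / 2 - 2 * t1
    · exact Or.inr (Or.inr (Or.inl (abs_le.mpr ⟨by linarith, by linarith⟩)))
    by_cases c4 : 3 * t2 ^ 2 + 3 * t3 ^ 2 ≤ t0 ^ 2 + t1 ^ 2 + 5 / 2 - 2 * t0 - 2 * t1
    · exact Or.inr (Or.inr (Or.inr (Or.inl (abs_le.mpr ⟨by linarith, by linarith⟩))))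
    exact Or.inr (Or.inr (Or.inr (Or.inr (abs_le.mpr ⟨by linarith, by linarith⟩))))

/-- **The two-candidate window for tolerance `1`.** For `t ∈ [0, ½]⁴` one of `t₀² + t₁² − b`,
`(1 − t₀)² + (1 − t₁)² − b` (`b = 3t₂² + 3t₃² ≤ 3/2`) lies in `[−1, 1]`. [folklore] -/
private theorem window_abs_le_one (t0 t1 t2 t3 : ℚ) (h0 : 0 ≤ t0) (h0' : t0 ≤ 1 / 2) (h1 : 0 ≤ t1)
    (h1' : t1 ≤ 1 / 2) (h2 : 0 ≤ t2) (h2' : t2 ≤ 1 / 2) (h3 : 0 ≤ t3) (h3' : t3 ≤ 1 / 2) :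
    |t0 ^ 2 + t1 ^ 2 - 3 * t2 ^ 2 - 3 * t3 ^ 2| ≤ 1 ∨
    |(1 - t0) ^ 2 + (1 - t1) ^ 2 - 3 * t2 ^ 2 - 3 * t3 ^ 2| ≤ 1 := by
  have k0 : 2 * t0 ^ 2 ≤ t0 := by nlinarith [mul_nonneg h0 (sub_nonneg.mpr h0')]
  have k1 : 2 * t1 ^ 2 ≤ t1 := by nlinarith [mul_nonneg h1 (sub_nonneg.mpr h1')]
  have k2 : 2 * t2 ^ 2 ≤ t2 := by nlinarith [mul_nonneg h2 (sub_nonneg.mpr h2')]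
  have k3 : 2 * t3 ^ 2 ≤ t3 := by nlinarith [mul_nonneg h3 (sub_nonneg.mpr h3')]
  have q0 : 0 ≤ t0 ^ 2 := sq_nonneg _
  have q1 : 0 ≤ t1 ^ 2 := sq_nonneg _
  have q2 : 0 ≤ t2 ^ 2 := sq_nonneg _
  have q3 : 0 ≤ t3 ^ 2 := sq_nonneg _
  have r0 : 0 ≤ t0 ^ 2 - 2 * t0 + 3 / 4 := by
    nlinarith [mul_nonneg (sub_nonneg.mpr h0') (by linarith : (0 : ℚ) ≤ 3 / 2 - t0)]
  have r1 : 0 ≤ t1 ^ 2 - 2 * t1 + 3 / 4 := by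
    nlinarith [mul_nonneg (sub_nonneg.mpr h1') (by linarith : (0 : ℚ) ≤ 3 / 2 - t1)]
  have e0 : (1 - t0) ^ 2 = 1 - 2 * t0 + t0 ^ 2 := by ring
  have e1 : (1 - t1) ^ 2 = 1 - 2 * t1 + t1 ^ 2 := by ring
  rw [e0, e1]
  by_cases c1 : 3 * t2 ^ 2 + 3 * t3 ^ 2 ≤ t0 ^ 2 + t1 ^ 2 + 1
  · exact Or.inl (abs_le.mpr ⟨by linarith, by linarith⟩)
  · exact Or.inr (abs_le.mpr ⟨by linarith, by linarith⟩)

end Window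

/-! ## §2 `M(O₆) ≤ ½`: every `ξ ∈ B` is within absolute norm `½` of `O₆` -/

section UpperBound

/-- Rounding with a sign and the half-integral companion: `u = r + σ|u − r|` with `r = round u ∈ ℤ`, `σ = ±1`,
`|u − r| ≤ ½`, and the integer `n = r + (σ − 1)/2` (so that `r + σ/2 = n + ½`). [folklore] -/
private theorem exists_round_sign_half (u : ℚ) :
    ∃ (r n σ : ℤ), σ ^ 2 = 1 ∧ u - r = σ * |u - r| ∧ |u - (r : ℚ)| ≤ 1 / 2 ∧ (n : ℚ) + 1 / 2 = r + (σ : ℚ) / 2 := by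
  refine ⟨round u, ?_⟩
  have hb : |u - round u| ≤ 1 / 2 := abs_sub_round u
  rcases le_or_gt 0 (u - round u) with h | h
  · exact ⟨round u, 1, by norm_num, by simp [abs_of_nonneg h], hb, by push_cast; ring⟩
  · exact ⟨round u - 1, -1, by norm_num, by simp [abs_of_neg h], hb, by push_cast; ring⟩

/-- The norm of a difference of explicit quaternions, in coordinates. [cite: Lang1982AbelianFunctions, Ch. IX §4] -/
private theorem norm_mk_sub_mk (x₀ x₁ x₂ x₃ g₀ g₁ g₂ g₃ : ℚ) :
    ((((⟨x₀, x₁, x₂, x₃⟩ : ℍ[ℚ,((-1 : ℤ) : ℚ),((3 : ℤ) : ℚ)]) - ⟨g₀, g₁, g₂, g₃⟩) *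
        star ((⟨x₀, x₁, x₂, x₃⟩ : ℍ[ℚ,((-1 : ℤ) : ℚ),((3 : ℤ) : ℚ)]) - ⟨g₀, g₁, g₂, g₃⟩)).re) =
      (x₀ - g₀) ^ 2 + (x₁ - g₁) ^ 2 - 3 * (x₂ - g₂) ^ 2 - 3 * (x₃ - g₃) ^ 2 := by
  rw [QuaternionAlgebra.mk_sub_mk, re_mul_star_eq_coords]

/-- `(σt − σc)² = (c − t)²` for `σ = ±1`. [folklore] -/
private theorem sq_sign_mul_sub {σ : ℤ} (hσ : σ ^ 2 = 1) (t c : ℚ) : (σ * t - σ * c) ^ 2 = (c - t) ^ 2 := by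
  have hσQ : ((σ : ℚ)) ^ 2 = 1 := by exact_mod_cast hσ
  linear_combination ((t - c) ^ 2) * hσQ

/-- **`M(O₆) ≤ M(ℚ) = ½` — Cerri–Chaubert–Lezowski's Theorem 3.4 (iii) for `K = ℚ`, `F = (−1,3)_ℚ`, `Λ = O₆`, made
explicit: for every `ξ ∈ B` there is `λ ∈ O₆` with `|nr(ξ − λ)| ≤ ½`.** Proof by the five-candidate covering of §1
(round every coordinate; four `𝔬`-translates, one `(e + 𝔬)`-translate), replacing the print's appeal to Eichler's Norm
Theorem (Lemma 3.1 (iii)). [cite: CerriChaubertLezowski2014, Thm 3.4 (iii) with Def. 2.6 and §2.3 (`M(ℚ) = ½`), for `K = ℚ`, `F = (−1,3)_ℚ`; proof by an explicit covering instead of Lemma 3.1 (iii)] -/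
theorem exists_maxOrder_abs_norm_sub_le_half (ξ : ℍ[ℚ,((-1 : ℤ) : ℚ),((3 : ℤ) : ℚ)]) :
    ∃ γ : ℍ[ℚ,((-1 : ℤ) : ℚ),((3 : ℤ) : ℚ)], (γ ∈ order (-1) 3 ∨ γ - ⟨1/2, 1/2, 1/2, -1/2⟩ ∈ order (-1) 3) ∧
      |((ξ - γ) * star (ξ - γ)).re| ≤ 1 / 2 := by
  obtain ⟨x₀, x₁, x₂, x₃⟩ := ξ
  obtain ⟨r0, n0, σ0, hσ0, hu0, hb0, hn0⟩ := exists_round_sign_half x₀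
  obtain ⟨r1, n1, σ1, hσ1, hu1, hb1, hn1⟩ := exists_round_sign_half x₁
  obtain ⟨r2, n2, σ2, hσ2, hu2, hb2, hn2⟩ := exists_round_sign_half x₂
  obtain ⟨r3, n3, σ3, hσ3, hu3, hb3, hn3⟩ := exists_round_sign_half x₃
  -- the squares of the three kinds of coordinate differences
  have s0 : (x₀ - r0) ^ 2 = |x₀ - r0| ^ 2 := (sq_abs _).symm
  have s1 : (x₁ - r1) ^ 2 = |x₁ - r1| ^ 2 := (sq_abs _).symm
  have s2 : (x₂ - r2) ^ 2 = |x₂ - r2| ^ 2 := (sq_abs _).symm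
  have s3 : (x₃ - r3) ^ 2 = |x₃ - r3| ^ 2 := (sq_abs _).symm
  have s0' : (x₀ - ((r0 + σ0 : ℤ) : ℚ)) ^ 2 = (1 - |x₀ - r0|) ^ 2 := by
    rw [show x₀ - ((r0 + σ0 : ℤ) : ℚ) = σ0 * |x₀ - r0| - σ0 * 1 by push_cast; linear_combination hu0]
    exact sq_sign_mul_sub hσ0 _ _
  have s1' : (x₁ - ((r1 + σ1 : ℤ) : ℚ)) ^ 2 = (1 - |x₁ - r1|) ^ 2 := by
    rw [show x₁ - ((r1 + σ1 : ℤ) : ℚ) = σ1 * |x₁ - r1| - σ1 * 1 by push_cast; linear_combination hu1]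
    exact sq_sign_mul_sub hσ1 _ _
  have s0'' : (x₀ - ((n0 : ℚ) + 1 / 2)) ^ 2 = (1 / 2 - |x₀ - r0|) ^ 2 := by
    rw [show x₀ - ((n0 : ℚ) + 1 / 2) = σ0 * |x₀ - r0| - σ0 * (1 / 2) by linear_combination hu0 - hn0]
    exact sq_sign_mul_sub hσ0 _ _
  have s1'' : (x₁ - ((n1 : ℚ) + 1 / 2)) ^ 2 = (1 / 2 - |x₁ - r1|) ^ 2 := by
    rw [show x₁ - ((n1 : ℚ) + 1 / 2) = σ1 * |x₁ - r1| - σ1 * (1 / 2) by linear_combination hu1 - hn1]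
    exact sq_sign_mul_sub hσ1 _ _
  have s2'' : (x₂ - ((n2 : ℚ) + 1 / 2)) ^ 2 = (1 / 2 - |x₂ - r2|) ^ 2 := by
    rw [show x₂ - ((n2 : ℚ) + 1 / 2) = σ2 * |x₂ - r2| - σ2 * (1 / 2) by linear_combination hu2 - hn2]
    exact sq_sign_mul_sub hσ2 _ _
  have s3'' : (x₃ - ((n3 : ℚ) + 1 / 2)) ^ 2 = (1 / 2 - |x₃ - r3|) ^ 2 := by
    rw [show x₃ - ((n3 : ℚ) + 1 / 2) = σ3 * |x₃ - r3| - σ3 * (1 / 2) by linear_combination hu3 - hn3]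
    exact sq_sign_mul_sub hσ3 _ _
  rcases window_abs_le_half |x₀ - r0| |x₁ - r1| |x₂ - r2| |x₃ - r3| (abs_nonneg _) hb0 (abs_nonneg _) hb1
      (abs_nonneg _) hb2 (abs_nonneg _) hb3 with h | h | h | h | h
  · -- `λ = r`
    refine ⟨⟨r0, r1, r2, r3⟩, Or.inl ⟨![r0, r1, r2, r3], by ext <;> simp [ofCoords]⟩, ?_⟩
    rw [norm_mk_sub_mk, s0, s1, s2, s3]
    exact h
  · -- `λ = r + σ₀e₀`
    refine ⟨⟨((r0 + σ0 : ℤ) : ℚ), r1, r2, r3⟩, Or.inl ⟨![r0 + σ0, r1, r2, r3], by ext <;> simp [ofCoords]⟩, ?_⟩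
    rw [norm_mk_sub_mk, s0', s1, s2, s3]
    exact h
  · -- `λ = r + σ₁e₁`
    refine ⟨⟨r0, ((r1 + σ1 : ℤ) : ℚ), r2, r3⟩, Or.inl ⟨![r0, r1 + σ1, r2, r3], by ext <;> simp [ofCoords]⟩, ?_⟩
    rw [norm_mk_sub_mk, s0, s1', s2, s3]
    exact h
  · -- `λ = r + σ₀e₀ + σ₁e₁`
    refine ⟨⟨((r0 + σ0 : ℤ) : ℚ), ((r1 + σ1 : ℤ) : ℚ), r2, r3⟩,
      Or.inl ⟨![r0 + σ0, r1 + σ1, r2, r3], by ext <;> simp [ofCoords]⟩, ?_⟩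
    rw [norm_mk_sub_mk, s0', s1', s2, s3]
    exact h
  · -- `λ = r + Σ σₖeₖ/2 ∈ e + 𝔬`
    refine ⟨⟨(n0 : ℚ) + 1 / 2, (n1 : ℚ) + 1 / 2, (n2 : ℚ) + 1 / 2, (n3 : ℚ) + 1 / 2⟩,
      Or.inr ⟨![n0, n1, n2, n3 + 1], ?_⟩, ?_⟩
    · rw [QuaternionAlgebra.mk_sub_mk]
      ext <;> simp [ofCoords]
      linarith
    · rw [norm_mk_sub_mk, s0'', s1'', s2'', s3'']
      have : (1 / 2 - |x₀ - ↑r0|) ^ 2 + (1 / 2 - |x₁ - ↑r1|) ^ 2 - 3 * (1 / 2 - |x₂ - ↑r2|) ^ 2 -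
          3 * (1 / 2 - |x₃ - ↑r3|) ^ 2 = (1 / 2 - |x₀ - ↑r0|) ^ 2 + (1 / 2 - |x₁ - ↑r1|) ^ 2 -
          3 * (1 / 2 - |x₂ - ↑r2|) ^ 2 - 3 * (1 / 2 - |x₃ - ↑r3|) ^ 2 := rfl
      exact h

/-- **Division with remainder of absolute norm AT MOST HALF the divisor** (Def. 1.2's inequality `N(a − bq) < N(b)`,
sharpened): for `a ∈ B` and `b ≠ 0` there is `q ∈ O₆` with `|nr(a − bq)| ≤ ½|nr b|` (take `ξ = b⁻¹a`; `N` is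
multiplicative). Sharp: §3 `one_le_abs_norm_one_sub_one_add_i_mul`.
[cite: CerriChaubertLezowski2014, Def. 1.2 and Thm 3.4 (iii) (`K = ℚ`, `M(ℚ) = ½`)] -/
theorem exists_maxOrder_abs_norm_sub_mul_le_half (a b : ℍ[ℚ,((-1 : ℤ) : ℚ),((3 : ℤ) : ℚ)]) (hb : b ≠ 0) :
    ∃ q : ℍ[ℚ,((-1 : ℤ) : ℚ),((3 : ℤ) : ℚ)], (q ∈ order (-1) 3 ∨ q - ⟨1/2, 1/2, 1/2, -1/2⟩ ∈ order (-1) 3) ∧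
      |((a - b * q) * star (a - b * q)).re| ≤ |(b * star b).re| / 2 := by
  obtain ⟨u, rfl⟩ := isUnit_of_ne_zero hb
  obtain ⟨q, hq, hle⟩ := exists_maxOrder_abs_norm_sub_le_half (↑u⁻¹ * a)
  refine ⟨q, hq, ?_⟩
  have hfac : a - ↑u * q = ↑u * (↑u⁻¹ * a - q) := by
    rw [mul_sub, ← mul_assoc, Units.mul_inv, one_mul]
  rw [hfac, re_mul_mul_star_mul, abs_mul]
  have hnn : 0 ≤ |((u : ℍ[ℚ,((-1 : ℤ) : ℚ),((3 : ℤ) : ℚ)]) * star (u : ℍ[ℚ,((-1 : ℤ) : ℚ),((3 : ℤ) : ℚ)])).re| :=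
    abs_nonneg _
  calc |((u : ℍ[ℚ,((-1 : ℤ) : ℚ),((3 : ℤ) : ℚ)]) * star (u : ℍ[ℚ,((-1 : ℤ) : ℚ),((3 : ℤ) : ℚ)])).re| *
        |((↑u⁻¹ * a - q) * star (↑u⁻¹ * a - q)).re|
      ≤ |((u : ℍ[ℚ,((-1 : ℤ) : ℚ),((3 : ℤ) : ℚ)]) * star (u : ℍ[ℚ,((-1 : ℤ) : ℚ),((3 : ℤ) : ℚ)])).re| * (1 / 2) :=
        mul_le_mul_of_nonneg_left hle hnn
    _ = _ := by ring

end UpperBound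

/-! ## §3 `m_{O₆}((1 + i)⁻¹) = ½`, attained — Lemma 3.7 for `t = 2`, `v = 1` -/

section LowerBound

/-- **`(1 + i)·ξ₀ = 1 = ξ₀·(1 + i)` for `ξ₀ = (1 − i)/2 = ⟨½, −½, 0, 0⟩`**: `ξ₀ = b⁻¹a` with `a = 1` (`nrd a = v = 1`)
and `b = 1 + i` the generator of `P₂ = bO₆` (`nrd b = t = 2`), as in the proof of Lemma 3.7.
[cite: CerriChaubertLezowski2014, Lemma 3.7 (proof: «`ξ = b⁻¹a`»)] [cite: BayerTravesa2007, §2 p. 318 (`w₂`)] -/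
theorem one_add_i_mul_xi0 :
    (⟨1, 1, 0, 0⟩ : ℍ[ℚ,((-1 : ℤ) : ℚ),((3 : ℤ) : ℚ)]) * ⟨1/2, -1/2, 0, 0⟩ = 1 ∧
      (⟨1/2, -1/2, 0, 0⟩ : ℍ[ℚ,((-1 : ℤ) : ℚ),((3 : ℤ) : ℚ)]) * ⟨1, 1, 0, 0⟩ = 1 := by
  constructor <;>
  · rw [QuaternionAlgebra.mk_mul_mk]
    ext <;> simp <;> norm_num

/-- `nr ξ₀ = ½` (`= N(a)/N(b) = 1/2`), `nr(1 + i) = 2`. [cite: CerriChaubertLezowski2014, Lemma 3.7 (proof)] -/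
theorem norm_xi0 :
    ((⟨1/2, -1/2, 0, 0⟩ : ℍ[ℚ,((-1 : ℤ) : ℚ),((3 : ℤ) : ℚ)]) * star ⟨1/2, -1/2, 0, 0⟩).re = 1 / 2 ∧
      ((⟨1, 1, 0, 0⟩ : ℍ[ℚ,((-1 : ℤ) : ℚ),((3 : ℤ) : ℚ)]) * star ⟨1, 1, 0, 0⟩).re = 2 := by
  constructor <;>
  · rw [re_mul_star_eq_coords]
    norm_num

/-- **`nr(ξ₀ − λ) ∈ ½ + ℤ` for every `λ ∈ O₆`** (`ξ₀ = (1 + i)⁻¹`): on `𝔬`, `(½ − λ₀)² + (½ + λ₁)² = ½ + λ₀(λ₀ − 1) +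
λ₁(λ₁ + 1)`; on `e + 𝔬` the two integral squares meet `3((m₂ + ½)² + (m₃ − ½)²) ∈ 3/2 + 3ℤ`. This is the print's
«`m_Λ(ξ) = |N(v + tz)|/|N(t)|`» with `v = 1`, `t = 2`. [cite: CerriChaubertLezowski2014, Lemma 3.7 (proof, display after (6))] -/
theorem exists_norm_xi0_sub_eq_add_half {γ : ℍ[ℚ,((-1 : ℤ) : ℚ),((3 : ℤ) : ℚ)]}
    (hγ : γ ∈ order (-1) 3 ∨ γ - ⟨1/2, 1/2, 1/2, -1/2⟩ ∈ order (-1) 3) :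
    ∃ k : ℤ, ((((⟨1/2, -1/2, 0, 0⟩ : ℍ[ℚ,((-1 : ℤ) : ℚ),((3 : ℤ) : ℚ)]) - γ) *
      star ((⟨1/2, -1/2, 0, 0⟩ : ℍ[ℚ,((-1 : ℤ) : ℚ),((3 : ℤ) : ℚ)]) - γ)).re) = k + 1 / 2 := by
  rcases hγ with ⟨m, rfl⟩ | ⟨m, hm⟩
  · refine ⟨m 0 ^ 2 - m 0 + m 1 ^ 2 + m 1 - 3 * m 2 ^ 2 - 3 * m 3 ^ 2, ?_⟩
    have hγ : ofCoords (-1) 3 (fun k ↦ ((m k : ℤ) : ℚ)) = ⟨m 0, m 1, m 2, m 3⟩ := by ext <;> simp [ofCoords]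
    rw [hγ, norm_mk_sub_mk]
    push_cast
    ring
  · refine ⟨m 0 ^ 2 + (1 + m 1) ^ 2 - 3 * m 2 ^ 2 - 3 * m 2 - 3 * m 3 ^ 2 + 3 * m 3 - 2, ?_⟩
    have hofc : ofCoords (-1) 3 (fun k ↦ ((m k : ℤ) : ℚ)) = ⟨m 0, m 1, m 2, m 3⟩ := by ext <;> simp [ofCoords]
    have hγ : γ = ⟨m 0 + 1 / 2, m 1 + 1 / 2, m 2 + 1 / 2, m 3 + -1 / 2⟩ := by
      -- `hm : ofCoords … = γ − e`, i.e. `γ = ofCoords … + e`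
      rw [(eq_sub_iff_add_eq.mp hm).symm, hofc, QuaternionAlgebra.mk_add_mk]
    rw [hγ, norm_mk_sub_mk]
    push_cast
    ring

/-- **`m_{O₆}(ξ₀) ≥ m_ℚ(½) = ½`: `½ ≤ |nr(ξ₀ − λ)|` for every `λ ∈ O₆`** — Lemma 3.7 for `F = (−1,3)_ℚ`, `t = 2`,
`v = 1`. With §2 this pins `M(O₆) = ½`. [cite: CerriChaubertLezowski2014, Lemma 3.7 (`K = ℚ`, `t = 2`, `v = 1`)] -/
theorem half_le_abs_norm_xi0_sub {γ : ℍ[ℚ,((-1 : ℤ) : ℚ),((3 : ℤ) : ℚ)]}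
    (hγ : γ ∈ order (-1) 3 ∨ γ - ⟨1/2, 1/2, 1/2, -1/2⟩ ∈ order (-1) 3) :
    1 / 2 ≤ |((((⟨1/2, -1/2, 0, 0⟩ : ℍ[ℚ,((-1 : ℤ) : ℚ),((3 : ℤ) : ℚ)]) - γ) *
      star ((⟨1/2, -1/2, 0, 0⟩ : ℍ[ℚ,((-1 : ℤ) : ℚ),((3 : ℤ) : ℚ)]) - γ)).re)| := by
  obtain ⟨k, hk⟩ := exists_norm_xi0_sub_eq_add_half hγ
  rw [hk]
  rcases le_or_gt 0 k with h | h
  · have hk0 : (0 : ℚ) ≤ k := by exact_mod_cast h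
    rw [abs_of_nonneg (by linarith)]
    linarith
  · have hk1 : (k : ℚ) + 1 ≤ 0 := by exact_mod_cast Int.lt_iff_add_one_le.mp h
    rw [abs_of_neg (by linarith)]
    linarith

/-- **The minimum at `ξ₀` is ATTAINED: `|nr(ξ₀ − 0)| = ½`** («for every `ξ ∈ F` there exists a `λ ∈ Λ` such that
`m_Λ(ξ) = N(ξ − λ)`»). [cite: CerriChaubertLezowski2014, Def. 2.6 (attainment remark)] -/
theorem abs_norm_xi0_sub_zero :
    |((((⟨1/2, -1/2, 0, 0⟩ : ℍ[ℚ,((-1 : ℤ) : ℚ),((3 : ℤ) : ℚ)]) - 0) *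
      star ((⟨1/2, -1/2, 0, 0⟩ : ℍ[ℚ,((-1 : ℤ) : ℚ),((3 : ℤ) : ℚ)]) - 0)).re)| = 1 / 2 := by
  rw [sub_zero, norm_xi0.1]
  norm_num

/-- **Eichler's inclusion on `P₂`, the mechanism (6) of Lemma 3.7: `nr(1 − y)` is ODD for every `y ∈ P₂`** (`y ∈ O₆`
with `2 ∣ nr y`): `nrd(1 + P₂) ⊆ nrd(1) + P₂ ∩ ℤ = 1 + 2ℤ`. Indeed `y ∈ P₂ ⊆ 𝔬` has `tr y = 2y₀` even and `nr y`
even, and `nr(1 − y) = 1 − tr y + nr y`. [cite: CerriChaubertLezowski2014, Lemma 3.1 (iii) (the inclusion `⊆`) and Lemma 3.7 (proof, (6))] [cite: VignerasLNM800, Ch. II §1 Lemme 1.5] -/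
theorem exists_norm_one_sub_eq_odd_of_primeTwo {y : ℍ[ℚ,((-1 : ℤ) : ℚ),((3 : ℤ) : ℚ)]}
    (hy : y ∈ order (-1) 3 ∨ y - ⟨1/2, 1/2, 1/2, -1/2⟩ ∈ order (-1) 3) (hN : ∃ N : ℤ, (y * star y).re = 2 * N) :
    ∃ k : ℤ, ((1 - y) * star (1 - y)).re = 2 * k + 1 := by
  obtain ⟨m, rfl, hdiv⟩ := (primeTwo_iff y).1 ⟨hy, hN⟩
  obtain ⟨q, hq⟩ := hdiv
  have h1 : (1 : ℍ[ℚ,((-1 : ℤ) : ℚ),((3 : ℤ) : ℚ)]) = ⟨1, 0, 0, 0⟩ := rfl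
  have hγ : ofCoords (-1) 3 (fun k ↦ ((m k : ℤ) : ℚ)) = ⟨m 0, m 1, m 2, m 3⟩ := by ext <;> simp [ofCoords]
  -- `nr(1 − y) = (1 − m₀)² + m₁² − 3m₂² − 3m₃² ≡ 1 + Σ mₖ (mod 2)`
  obtain ⟨a0, ha0⟩ := Int.even_mul_succ_self (m 0)
  obtain ⟨a1, ha1⟩ := Int.even_mul_succ_self (m 1)
  obtain ⟨a2, ha2⟩ := Int.even_mul_succ_self (m 2)
  obtain ⟨a3, ha3⟩ := Int.even_mul_succ_self (m 3)
  refine ⟨-q - m 0 + 2 * m 2 + 2 * m 3 + a0 + a1 - 3 * a2 - 3 * a3, ?_⟩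
  have ha0' : (m 0 : ℚ) * (m 0 + 1) = a0 + a0 := by exact_mod_cast ha0
  have ha1' : (m 1 : ℚ) * (m 1 + 1) = a1 + a1 := by exact_mod_cast ha1
  have ha2' : (m 2 : ℚ) * (m 2 + 1) = a2 + a2 := by exact_mod_cast ha2
  have ha3' : (m 3 : ℚ) * (m 3 + 1) = a3 + a3 := by exact_mod_cast ha3
  have hq' : (m 0 : ℚ) + m 1 + m 2 + m 3 = 2 * q := by exact_mod_cast hq
  rw [hγ, h1, norm_mk_sub_mk]
  push_cast
  linear_combination ha0' + ha1' - 3 * ha2' - 3 * ha3' - hq'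

/-- **The division bound of §2 is SHARP — Lemma 3.7 in the form of Def. 1.2: for `(a, b) = (1, 1 + i)` every
`q ∈ O₆` has `N(a − bq) ≥ 1 = ½N(b)`**, because `bq ∈ P₂` and `nr(1 − bq)` is odd.
[cite: CerriChaubertLezowski2014, Lemma 3.7 (proof) with Def. 1.2] -/
theorem one_le_abs_norm_one_sub_one_add_i_mul {q : ℍ[ℚ,((-1 : ℤ) : ℚ),((3 : ℤ) : ℚ)]}
    (hq : q ∈ order (-1) 3 ∨ q - ⟨1/2, 1/2, 1/2, -1/2⟩ ∈ order (-1) 3) :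
    1 ≤ |((1 - (⟨1, 1, 0, 0⟩ : ℍ[ℚ,((-1 : ℤ) : ℚ),((3 : ℤ) : ℚ)]) * q) *
      star (1 - (⟨1, 1, 0, 0⟩ : ℍ[ℚ,((-1 : ℤ) : ℚ),((3 : ℤ) : ℚ)]) * q)).re| := by
  -- `1 − bq = b(ξ₀ − q)` and `nr b = 2`, `nr(ξ₀ − q) ∈ ½ + ℤ`
  have hfac : (1 : ℍ[ℚ,((-1 : ℤ) : ℚ),((3 : ℤ) : ℚ)]) - ⟨1, 1, 0, 0⟩ * q =
      ⟨1, 1, 0, 0⟩ * ((⟨1/2, -1/2, 0, 0⟩ : ℍ[ℚ,((-1 : ℤ) : ℚ),((3 : ℤ) : ℚ)]) - q) := by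
    rw [mul_sub, one_add_i_mul_xi0.1]
  rw [hfac, re_mul_mul_star_mul, norm_xi0.2, abs_mul, abs_two]
  have := half_le_abs_norm_xi0_sub hq
  linarith

end LowerBound

/-! ## §4 `M(O₆) = ½`, and the same for every maximal order `uO₆u⁻¹` -/

section Minimum

/-- **THE EUCLIDEAN MINIMUM OF `O₆` IS `½`, ATTAINED: `M(O₆) = M(ℚ) = ½`** — every `ξ ∈ B` has some `λ ∈ O₆` with
`N(ξ − λ) ≤ ½` (Thm 3.4 (iii)); `ξ₀ = (1 + i)⁻¹` has `N(ξ₀ − λ) ≥ ½` for all `λ ∈ O₆` (Lemma 3.7); and `N(ξ₀ − 0) = ½`.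
[cite: CerriChaubertLezowski2014, Thm 3.4 (iii), Lemma 3.7, Def. 2.6 (for `K = ℚ`, `F = (−1,3)_ℚ`)] -/
theorem euclideanMinimum_maxOrder :
    (∀ ξ : ℍ[ℚ,((-1 : ℤ) : ℚ),((3 : ℤ) : ℚ)], ∃ γ : ℍ[ℚ,((-1 : ℤ) : ℚ),((3 : ℤ) : ℚ)],
        (γ ∈ order (-1) 3 ∨ γ - ⟨1/2, 1/2, 1/2, -1/2⟩ ∈ order (-1) 3) ∧ |((ξ - γ) * star (ξ - γ)).re| ≤ 1 / 2) ∧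
      (∀ γ : ℍ[ℚ,((-1 : ℤ) : ℚ),((3 : ℤ) : ℚ)], (γ ∈ order (-1) 3 ∨ γ - ⟨1/2, 1/2, 1/2, -1/2⟩ ∈ order (-1) 3) →
        1 / 2 ≤ |((((⟨1/2, -1/2, 0, 0⟩ : ℍ[ℚ,((-1 : ℤ) : ℚ),((3 : ℤ) : ℚ)]) - γ) *
          star ((⟨1/2, -1/2, 0, 0⟩ : ℍ[ℚ,((-1 : ℤ) : ℚ),((3 : ℤ) : ℚ)]) - γ)).re)|) ∧
      (∃ γ : ℍ[ℚ,((-1 : ℤ) : ℚ),((3 : ℤ) : ℚ)], (γ ∈ order (-1) 3 ∨ γ - ⟨1/2, 1/2, 1/2, -1/2⟩ ∈ order (-1) 3) ∧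
        |((((⟨1/2, -1/2, 0, 0⟩ : ℍ[ℚ,((-1 : ℤ) : ℚ),((3 : ℤ) : ℚ)]) - γ) *
          star ((⟨1/2, -1/2, 0, 0⟩ : ℍ[ℚ,((-1 : ℤ) : ℚ),((3 : ℤ) : ℚ)]) - γ)).re)| = 1 / 2) :=
  ⟨exists_maxOrder_abs_norm_sub_le_half, fun _ hγ ↦ half_le_abs_norm_xi0_sub hγ,
    ⟨0, Or.inl (Subring.zero_mem _), abs_norm_xi0_sub_zero⟩⟩

/-- `nr(uyu⁻¹) = nr y`. [cite: CerriChaubertLezowski2014, §1 («The map `N` is multiplicative»)] -/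
private theorem norm_unitsConj_eq' (u : (ℍ[ℚ,((-1 : ℤ) : ℚ),((3 : ℤ) : ℚ)])ˣ) (y : ℍ[ℚ,((-1 : ℤ) : ℚ),((3 : ℤ) : ℚ)]) :
    ((↑u * y * ↑u⁻¹) * star (↑u * y * ↑u⁻¹ : ℍ[ℚ,((-1 : ℤ) : ℚ),((3 : ℤ) : ℚ)])).re = (y * star y).re := by
  have h := norm_unitsConj_eq u⁻¹ y
  rwa [inv_inv] at h

/-- **Every conjugate maximal order `Λ′ = uO₆u⁻¹` has `M(Λ′) ≤ ½` too** («`M(Λ′) = M(Λ)`»; all maximal orders of `B`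
are of this form, g33-#2): for every `ξ` some `γ` with `u⁻¹γu ∈ O₆` has `|nr(ξ − γ)| ≤ ½`.
[cite: CerriChaubertLezowski2014, Prop. 2.8 and Remark 2.9 with Thm 3.4 (iii)] -/
theorem exists_conj_maxOrder_abs_norm_sub_le_half (u : (ℍ[ℚ,((-1 : ℤ) : ℚ),((3 : ℤ) : ℚ)])ˣ)
    (ξ : ℍ[ℚ,((-1 : ℤ) : ℚ),((3 : ℤ) : ℚ)]) :
    ∃ γ : ℍ[ℚ,((-1 : ℤ) : ℚ),((3 : ℤ) : ℚ)],
      (↑u⁻¹ * γ * ↑u ∈ order (-1) 3 ∨ ↑u⁻¹ * γ * ↑u - ⟨1/2, 1/2, 1/2, -1/2⟩ ∈ order (-1) 3) ∧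
      |((ξ - γ) * star (ξ - γ)).re| ≤ 1 / 2 := by
  obtain ⟨γ', hγ', hle⟩ := exists_maxOrder_abs_norm_sub_le_half (↑u⁻¹ * ξ * ↑u)
  refine ⟨↑u * γ' * ↑u⁻¹, ?_, ?_⟩
  · have : (↑u⁻¹ * (↑u * γ' * ↑u⁻¹) * ↑u : ℍ[ℚ,((-1 : ℤ) : ℚ),((3 : ℤ) : ℚ)]) = γ' := by
      simp only [mul_assoc, Units.inv_mul_cancel_left, Units.inv_mul, mul_one]
    rw [this]; exact hγ'
  · have hξ : ξ - ↑u * γ' * ↑u⁻¹ = ↑u * (↑u⁻¹ * ξ * ↑u - γ') * ↑u⁻¹ := by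
      simp only [mul_sub, sub_mul, mul_assoc, Units.mul_inv_cancel_left, Units.mul_inv, mul_one]
    rw [hξ, norm_unitsConj_eq']
    exact hle

/-- **… and `M(Λ′) ≥ ½` at `ξ = uξ₀u⁻¹`**: every `γ` with `u⁻¹γu ∈ O₆` has `½ ≤ |nr(uξ₀u⁻¹ − γ)|`. Hence `M(Λ′) = ½`
for every maximal order `Λ′` of `B` — «`M(B) = ½`». [cite: CerriChaubertLezowski2014, Prop. 2.8, Remark 2.9, p. 189 («`M(F) = M(Λ)` for any maximal order»), with Lemma 3.7] -/
theorem half_le_abs_norm_conj_xi0_sub (u : (ℍ[ℚ,((-1 : ℤ) : ℚ),((3 : ℤ) : ℚ)])ˣ)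
    {γ : ℍ[ℚ,((-1 : ℤ) : ℚ),((3 : ℤ) : ℚ)]}
    (hγ : ↑u⁻¹ * γ * ↑u ∈ order (-1) 3 ∨ ↑u⁻¹ * γ * ↑u - ⟨1/2, 1/2, 1/2, -1/2⟩ ∈ order (-1) 3) :
    1 / 2 ≤ |(((↑u * (⟨1/2, -1/2, 0, 0⟩ : ℍ[ℚ,((-1 : ℤ) : ℚ),((3 : ℤ) : ℚ)]) * ↑u⁻¹ - γ) *
      star (↑u * (⟨1/2, -1/2, 0, 0⟩ : ℍ[ℚ,((-1 : ℤ) : ℚ),((3 : ℤ) : ℚ)]) * ↑u⁻¹ - γ)).re)| := by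
  have hξ : (↑u * (⟨1/2, -1/2, 0, 0⟩ : ℍ[ℚ,((-1 : ℤ) : ℚ),((3 : ℤ) : ℚ)]) * ↑u⁻¹ - γ) =
      ↑u * ((⟨1/2, -1/2, 0, 0⟩ : ℍ[ℚ,((-1 : ℤ) : ℚ),((3 : ℤ) : ℚ)]) - ↑u⁻¹ * γ * ↑u) * ↑u⁻¹ := by
    simp only [mul_sub, sub_mul, mul_assoc, Units.mul_inv_cancel_left, Units.mul_inv, mul_one]
  rw [hξ, norm_unitsConj_eq']
  exact half_le_abs_norm_xi0_sub hγ

end Minimum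

/-! ## §5 Lang's order: `M(𝔬) = 1`, attained -/

section LangOrder

/-- **`M(𝔬) ≤ 1`: for every `ξ ∈ B` there is `γ ∈ 𝔬` with `|nr(ξ − γ)| ≤ 1`** (round every coordinate; if
`3(t₂² + t₃²) > t₀² + t₁² + 1`, move `ξ₀, ξ₁` across to `1 − t₀, 1 − t₁`). With g33-#2 `one_le_abs_norm_e_sub_order`
the bound `1` is attained at `ξ = e`, so `𝔬` fails Prop. 2.7 (iii) «`m_Λ(ξ) < 1`» exactly at the boundary.
[cite: CerriChaubertLezowski2014, Def. 2.6 and Prop. 2.7 (iii), read for the non-maximal order `𝔬 ⊂ (−1,3)_ℚ`] -/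
theorem exists_order_abs_norm_sub_le_one (ξ : ℍ[ℚ,((-1 : ℤ) : ℚ),((3 : ℤ) : ℚ)]) :
    ∃ γ ∈ order (-1) 3, |((ξ - γ) * star (ξ - γ)).re| ≤ 1 := by
  obtain ⟨x₀, x₁, x₂, x₃⟩ := ξ
  obtain ⟨r0, -, σ0, hσ0, hu0, hb0, -⟩ := exists_round_sign_half x₀
  obtain ⟨r1, -, σ1, hσ1, hu1, hb1, -⟩ := exists_round_sign_half x₁
  obtain ⟨r2, -, σ2, -, -, hb2, -⟩ := exists_round_sign_half x₂
  obtain ⟨r3, -, σ3, -, -, hb3, -⟩ := exists_round_sign_half x₃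
  have s0 : (x₀ - r0) ^ 2 = |x₀ - r0| ^ 2 := (sq_abs _).symm
  have s1 : (x₁ - r1) ^ 2 = |x₁ - r1| ^ 2 := (sq_abs _).symm
  have s2 : (x₂ - r2) ^ 2 = |x₂ - r2| ^ 2 := (sq_abs _).symm
  have s3 : (x₃ - r3) ^ 2 = |x₃ - r3| ^ 2 := (sq_abs _).symm
  have s0' : (x₀ - ((r0 + σ0 : ℤ) : ℚ)) ^ 2 = (1 - |x₀ - r0|) ^ 2 := by
    rw [show x₀ - ((r0 + σ0 : ℤ) : ℚ) = σ0 * |x₀ - r0| - σ0 * 1 by push_cast; linear_combination hu0]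
    exact sq_sign_mul_sub hσ0 _ _
  have s1' : (x₁ - ((r1 + σ1 : ℤ) : ℚ)) ^ 2 = (1 - |x₁ - r1|) ^ 2 := by
    rw [show x₁ - ((r1 + σ1 : ℤ) : ℚ) = σ1 * |x₁ - r1| - σ1 * 1 by push_cast; linear_combination hu1]
    exact sq_sign_mul_sub hσ1 _ _
  rcases window_abs_le_one |x₀ - r0| |x₁ - r1| |x₂ - r2| |x₃ - r3| (abs_nonneg _) hb0 (abs_nonneg _) hb1
      (abs_nonneg _) hb2 (abs_nonneg _) hb3 with h | h
  · refine ⟨⟨r0, r1, r2, r3⟩, ⟨![r0, r1, r2, r3], by ext <;> simp [ofCoords]⟩, ?_⟩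
    rw [norm_mk_sub_mk, s0, s1, s2, s3]
    exact h
  · refine ⟨⟨((r0 + σ0 : ℤ) : ℚ), ((r1 + σ1 : ℤ) : ℚ), r2, r3⟩,
      ⟨![r0 + σ0, r1 + σ1, r2, r3], by ext <;> simp [ofCoords]⟩, ?_⟩
    rw [norm_mk_sub_mk, s0', s1', s2, s3]
    exact h

/-- `|nr e| = 1` (`nr e = ¼ + ¼ − ¾ − ¾ = −1`): the bound `1` for `𝔬` is attained at `ξ = e`, `γ = 0`.
[cite: Lang1982AbelianFunctions, Ch. IX §4] -/
theorem abs_norm_e_sub_zero :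
    |((((⟨1/2, 1/2, 1/2, -1/2⟩ : ℍ[ℚ,((-1 : ℤ) : ℚ),((3 : ℤ) : ℚ)]) - 0) *
      star ((⟨1/2, 1/2, 1/2, -1/2⟩ : ℍ[ℚ,((-1 : ℤ) : ℚ),((3 : ℤ) : ℚ)]) - 0)).re)| = 1 := by
  rw [sub_zero, re_mul_star_eq_coords]
  norm_num

/-- **THE EUCLIDEAN MINIMUM OF LANG'S ORDER IS `1`, ATTAINED: `M(𝔬) = 1`** — every `ξ` is served within `1`; `ξ = e`
is never served below `1` (g33-#2); and `|nr(e − 0)| = 1`. So `𝔬 ⊊ O₆` is not norm-Euclidean (Prop. 2.7 (iii) needs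
`< 1`) while its Euclidean minimum is the least value compatible with that.
[cite: CerriChaubertLezowski2014, Def. 2.6, Prop. 2.5 (ii), Prop. 2.7 (iii)] -/
theorem euclideanMinimum_order :
    (∀ ξ : ℍ[ℚ,((-1 : ℤ) : ℚ),((3 : ℤ) : ℚ)], ∃ γ ∈ order (-1) 3, |((ξ - γ) * star (ξ - γ)).re| ≤ 1) ∧
      (∀ γ ∈ order (-1) 3, 1 ≤ |((((⟨1/2, 1/2, 1/2, -1/2⟩ : ℍ[ℚ,((-1 : ℤ) : ℚ),((3 : ℤ) : ℚ)]) - γ) *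
        star ((⟨1/2, 1/2, 1/2, -1/2⟩ : ℍ[ℚ,((-1 : ℤ) : ℚ),((3 : ℤ) : ℚ)]) - γ)).re)|) ∧
      (∃ γ ∈ order (-1) 3, |((((⟨1/2, 1/2, 1/2, -1/2⟩ : ℍ[ℚ,((-1 : ℤ) : ℚ),((3 : ℤ) : ℚ)]) - γ) *
        star ((⟨1/2, 1/2, 1/2, -1/2⟩ : ℍ[ℚ,((-1 : ℤ) : ℚ),((3 : ℤ) : ℚ)]) - γ)).re)| = 1) :=
  ⟨exists_order_abs_norm_sub_le_one, fun _ hγ ↦ one_le_abs_norm_e_sub_order hγ,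
    ⟨0, Subring.zero_mem _, abs_norm_e_sub_zero⟩⟩

/-- **`M(𝔬) = 1 > ½ = M(O₆)`, numerically: the two orders are told apart by their Euclidean minima** — `e` is served
within `½` by `O₆ ∋ e` (indeed at `0`) but never below `1` by `𝔬`. [cite: CerriChaubertLezowski2014, Prop. 2.5 (ii) («If `Λ` is Euclidean, then `Λ` is maximal»)] -/
theorem euclideanMinimum_order_gt_maxOrder :
    (∃ γ : ℍ[ℚ,((-1 : ℤ) : ℚ),((3 : ℤ) : ℚ)], (γ ∈ order (-1) 3 ∨ γ - ⟨1/2, 1/2, 1/2, -1/2⟩ ∈ order (-1) 3) ∧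
        |((((⟨1/2, 1/2, 1/2, -1/2⟩ : ℍ[ℚ,((-1 : ℤ) : ℚ),((3 : ℤ) : ℚ)]) - γ) *
          star ((⟨1/2, 1/2, 1/2, -1/2⟩ : ℍ[ℚ,((-1 : ℤ) : ℚ),((3 : ℤ) : ℚ)]) - γ)).re)| = 0) ∧
      ∀ γ ∈ order (-1) 3, (1 : ℚ) / 2 < |((((⟨1/2, 1/2, 1/2, -1/2⟩ : ℍ[ℚ,((-1 : ℤ) : ℚ),((3 : ℤ) : ℚ)]) - γ) *
        star ((⟨1/2, 1/2, 1/2, -1/2⟩ : ℍ[ℚ,((-1 : ℤ) : ℚ),((3 : ℤ) : ℚ)]) - γ)).re)| := by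
  refine ⟨⟨⟨1/2, 1/2, 1/2, -1/2⟩, Or.inr (by rw [sub_self]; exact Subring.zero_mem _), ?_⟩, fun γ hγ ↦ ?_⟩
  · rw [sub_self, zero_mul, QuaternionAlgebra.re_zero, abs_zero]
  · have := one_le_abs_norm_e_sub_order hγ
    linarith

end LangOrder

end Literature.Geometry.Kaehler.ComplexTorus.QuaternionType
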